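import Literature.NumberTheory.QuadraticForms.HermitianUnimodularLocalRing
import Literature.NumberTheory.QuadraticForms.HilbertSymbolAtUnramifiedPlace
import Literature.NumberTheory.Automorphic.Liu2021.LemD1IsotropyOfPlace
import Literature.NumberTheory.Automorphic.UnitaryGroupNonsplitPlace
import Literature.NumberTheory.Automorphic.UnitaryGroupSplitPlace
import Literature.NumberTheory.Automorphic.IwasawaDecompositionAdelic
import HarnessLib

/-!
# Unimodular hermitian lattices at an INERT place have a hyperbolic (antidiagonal) basis
# (piece (2a) `HyperbolicBasis` of the line `b4-hyperspecial-gelfand-pair`; fan B, rung B-IV, row IV-9; cell hodgecm-mathlib)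

Topic `NumberTheory/Automorphic`; namespace `Literature.NumberTheory.Automorphic.UnitaryGroup`.  KERNEL ONLY: theorems, no
definition, no named fact, no `sorry`.

**Statement** (`exists_glInt_placeForm_eq_formCongr_antidiagonal`, the sub-stub (2a) of the cell's skeleton
`b4-hyperspecial-gelfand-pair` v3, sha16 9a4ac4416ebf167b, binders verbatim).  `E/F` a quadratic extension of number fields with
non-trivial automorphism `c`, `J ∈ M_N(E)` `c`-hermitian with `det J` a unit, `v` a finite place of `F` that is UNRAMIFIED in `E`,
NON-DYADIC (`2 ∉ v`) and NON-SPLIT (`c • w = w` for the place `w ∣ v`), at which `J` is `w`-UNIMODULAR (`J_w := placeForm J w ∈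
GL_N(𝒪_w)`).  Then there is `T ∈ GL_N(𝒪_w)` with `J_w = (σ_w T)ᵀ · J₀ · T`, `σ_w = galAdicCompletionMap c hw` the local Galois
involution of `E_w` and `J₀ = antidiag(1, …, 1)` (`StdForm.antidiagonal`): the unimodular hermitian `𝒪_w`-lattice `(𝒪_wᴺ, J_w)`
has a HYPERBOLIC basis (plus the unit vector in the middle for odd `N`) — [Jacobowitz1962, §7 Thm. 7.1]: over an unramified
quadratic extension a unimodular hermitian lattice is determined by its rank.

**Proof.**  The pure algebra is the tree's `QuadraticForms.HermitianUnimodular.exists_formCongr_eq`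
(`QuadraticForms/HermitianUnimodularLocalRing.lean`): over a LOCAL ring `R` with involution `σ` such that (trace) `b + σ b = 1`
is soluble and (norm) every `σ`-fixed unit is a norm `t σ(t)`, any two unimodular `σ`-hermitian matrices are `GL_N(R)`-congruent.
This file supplies the two hypotheses for `R = 𝒪_w = 𝒪[E_w]` (a discrete valuation ring, Mathlib), `σ = σ_w|_{𝒪_w}`:
* §1 `σ_w` preserves `𝒪_w` and is an involution (`galAdicCompletionMap` preserves the valuation; `c² = 1`); `σ_w`-fixed elements
  of `E_w` come from `F_v` (`exists_toPlace_eq_of_galAdicCompletionMap_eq`: via `E ⊗_F F_v = E_w` at a non-split place and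
  the tree's `LemD1OfPlace.exists_toLocalRing_eq_of_conjLocal_eq`);
* §2 (trace) `b = ½ ∈ 𝒪_w` at a non-dyadic place;
* §3 (norm) **units of `𝒪_v` are norms of units of `𝒪_w` at an unramified place** — the tree's
  `QuadraticForms.exists_sq_sub_mul_sq_eq_of_valued_eq_one_of_isUnramifiedIn` ([Omeara1963, 63:16], all residue
  characteristics) read in `E_w = F_v(δ)`: `u = x² - d y² = (x + yδ)(x - yδ) = t · σ_w t`, and `|t|_w = 1` because `σ_w` preserves
  `|·|_w`;
* §4 the statement: pull `J_w` and `J₀` back to `GL_N(𝒪_w)`, apply `exists_formCongr_eq`, push the congruence forward along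
  `𝒪_w ↪ E_w`.

HC_CM is proved only modulo the 7 printed citations until rung 0 closes; this file is a rung-0 piece (row IV-9), not a binder.

## References
* [Jacobowitz1962] R. Jacobowitz, *Hermitian forms over local fields*, Amer. J. Math. 84 (1962), §7 Thm. 7.1.
* [Omeara1963] O. T. O'Meara, *Introduction to quadratic forms*, §63C Example 63:16 (units are norms at unramified places).
* [Serre1979] J.-P. Serre, *Local Fields*, Ch. V §2.
-/

set_option autoImplicit false

noncomputable section

open NumberField IsDedekindDomain
open scoped Matrix ValuativeRel

namespace Literature.NumberTheory.Automorphic.UnitaryGroup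

open Literature.NumberTheory.Automorphic Literature.NumberTheory.QuadraticForms

variable {F E : Type} [Field F] [NumberField F] [Field E] [NumberField E] [Algebra F E]
  [Algebra.IsQuadraticExtension F E] (c : E ≃ₐ[F] E) {v : HeightOneSpectrum (𝓞 F)} (w : PlacesOver E v)

/-! ## §1 The local involution `σ_w` at a non-split place -/

/-- `σ_w ∘ σ_w = id` on `E_w` for the non-trivial automorphism `c` of the quadratic extension (`c² = 1`) at a place `w` fixed by
`c`. [cite: CasselsFrohlichANT1967, Ch. VII §1.1] -/
theorem galAdicCompletionMap_galAdicCompletionMap_of_smul_eq (hc : c ≠ 1) (hw : c • w.1 = w.1) (x : w.1.adicCompletion E) :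
    galAdicCompletionMap (L := E) c hw (galAdicCompletionMap (L := E) c hw x) = x := by
  rw [galAdicCompletionMap_galAdicCompletionMap,
    galAdicCompletionMap_congr_left E (Literature.NumberTheory.Automorphic.algEquiv_mul_self_eq_one (F := F) hc) _ (one_smul _ _),
    galAdicCompletionMap_one]

omit [NumberField F] [Algebra.IsQuadraticExtension F E] in
/-- `σ_w` maps the valuation ring `𝒪[E_w]` (the `ValuativeRel` integers keying `glInt`) into itself — it preserves `|·|_w`.
[cite: CasselsFrohlichANT1967, Ch. VII §1.1] -/
theorem galAdicCompletionMap_mem_integer (hw : c • w.1 = w.1) {x : w.1.adicCompletion E}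
    (hx : x ∈ 𝒪[w.1.adicCompletion E]) : galAdicCompletionMap (L := E) c hw x ∈ 𝒪[w.1.adicCompletion E] := by
  rw [mem_integer_iff_mem_adicCompletionIntegers] at hx ⊢
  exact (galAdicCompletionMap_mem_adicCompletionIntegers_iff E c hw x).2 hx

/-- **`σ_w`-fixed elements of `E_w` come from `F_v`** at a NON-SPLIT place: if `σ_w u = u` then `u = ι_w p` for some `p ∈ F_v`
(`E ⊗_F F_v = E_w` has the single factor `w`; the fixed points of `c ⊗ 1` are `ι_v(F_v)`,
`LemD1OfPlace.exists_toLocalRing_eq_of_conjLocal_eq`). [cite: CasselsFrohlichANT1967, Ch. II §10] -/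
theorem exists_toPlace_eq_of_galAdicCompletionMap_eq (hc : c ≠ 1) (hw : c • w.1 = w.1) (u : w.1.adicCompletion E)
    (hu : galAdicCompletionMap (L := E) c hw u = u) : ∃ p : v.adicCompletion F, toPlace v w p = u := by
  -- `c` negates some `δ ≠ 0`
  obtain ⟨σ, δ, hσδ, hδ⟩ := exists_algEquiv_apply_eq_neg (F := F) (E := E)
  have hσ1 : σ ≠ 1 := by
    rintro rfl
    rw [AlgEquiv.one_apply] at hσδ
    have h2 : (2 : E) * δ = 0 := by linear_combination hσδ
    exact hδ ((mul_eq_zero.mp h2).resolve_left two_ne_zero)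
  obtain rfl : σ = c := (Literature.NumberTheory.Automorphic.algEquiv_eq_one_or_eq (F := F) hc σ).resolve_left hσ1
  -- the element of `E ⊗ F_v = Π_{w' ∣ v} E_{w'}` with `w`-component `u` (one factor)
  haveI : Subsingleton (PlacesOver E v) := PlacesOver.subsingleton_of_smul_eq σ hc w hw
  letI : Unique (PlacesOver E v) := uniqueOfSubsingleton w
  let π : LocalRing E v ≃+* w.1.adicCompletion E := RingEquiv.piUnique fun w' : PlacesOver E v => w'.1.adicCompletion E
  obtain ⟨x, hxw⟩ : ∃ x : LocalRing E v, x w = u := ⟨π.symm u, π.apply_symm_apply u⟩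
  have hconj : conjLocal E σ v x = x := by
    rw [LocalRing.eq_iff_apply_eq σ hc w hw, conjLocal_apply]
    have key : ∀ (w₁ : PlacesOver E v) (h₁ : σ • w₁.1 = w.1), galAdicCompletionMap (L := E) σ h₁ (x w₁) = x w := by
      intro w₁ h₁
      obtain rfl : w₁ = w := Subsingleton.elim w₁ w
      rw [hxw]
      exact hu
    exact key ⟨σ⁻¹ • w.1, under_inv_smul_eq σ w⟩ (smul_inv_smul σ w.1)
  obtain ⟨p, hp⟩ := Liu2021.LemD1OfPlace.exists_toLocalRing_eq_of_conjLocal_eq E v σ hσδ hδ x hconj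
  exact ⟨p, by rw [← hxw, ← hp, toLocalRing_apply]⟩

/-! ## §2 The hermitian form `J_w` and the antidiagonal form over `𝒪_w` -/

omit [NumberField F] [Algebra.IsQuadraticExtension F E] in
/-- `J_w = placeForm J w` is `σ_w`-hermitian when `J` is `c`-hermitian (`σ_w` extends `c`).
[cite: PlatonovRapinchuk1994, §5.1] -/
theorem placeForm_hermitian_of_smul_eq {N : ℕ} (J : Matrix (Fin N) (Fin N) E) (hJh : (J.map c)ᵀ = J) (hw : c • w.1 = w.1) :
    ((placeForm J w.1).map (galAdicCompletionMap (L := E) c hw))ᵀ = placeForm J w.1 := by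
  refine Matrix.ext fun i j => ?_
  have hij : c (J j i) = J i j := by
    have h := congrFun (congrFun hJh i) j
    simpa only [Matrix.transpose_apply, Matrix.map_apply] using h
  simp only [placeForm, Matrix.map_apply, Matrix.transpose_apply,
    IsDedekindDomain.HeightOneSpectrum.algebraMap_adicCompletion, Function.comp_apply, Algebra.algebraMap_self,
    RingHom.id_apply, galAdicCompletionMap_coe_algEquiv, hij]

/-! ## §3 Trace and norm hypotheses for `𝒪_w` at an unramified non-dyadic non-split place -/

omit [NumberField F] [NumberField E] [Algebra.IsQuadraticExtension F E] in
/-- a place of `E` above `v ∤ 2` does not divide `2` (`v = w ∩ 𝓞 F`). [cite: NeukirchANT1999, Ch. I §8] -/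
private theorem two_notMem (h2 : (2 : 𝓞 F) ∉ v.asIdeal) : (2 : 𝓞 E) ∉ w.1.asIdeal := by
  intro h
  apply h2
  have hv : v.asIdeal = (w.1.asIdeal).under (𝓞 F) := by rw [← HeightOneSpectrum.under_asIdeal, w.2]
  rw [hv, Ideal.under_def, Ideal.mem_comap, map_ofNat]
  exact h

omit [NumberField F] [Algebra.IsQuadraticExtension F E] in
/-- `|2|_w = 1` at a place above a non-dyadic `v`. [folklore] -/
private theorem valued_two_eq_one (h2 : (2 : 𝓞 F) ∉ v.asIdeal) : Valued.v (2 : w.1.adicCompletion E) = 1 := by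
  have h := valued_algebraMap_eq_one E w.1 (two_notMem w h2)
  rwa [map_ofNat] at h

omit [NumberField F] [Algebra.IsQuadraticExtension F E] in
/-- the coercion `E → E_w` is the algebra map. [folklore] -/
private theorem coe_eq_algebraMap (x : E) : ((x : E) : w.1.adicCompletion E) = algebraMap E (w.1.adicCompletion E) x := by
  rw [IsDedekindDomain.HeightOneSpectrum.algebraMap_adicCompletion]
  rfl

omit [NumberField F] [Algebra.IsQuadraticExtension F E] in
/-- `σ_w (e ⊗ 1) = (c e) ⊗ 1` on the image of `E`. [cite: CasselsFrohlichANT1967, Ch. VII §1.1] -/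
private theorem galAdicCompletionMap_algebraMap (hw : c • w.1 = w.1) (x : E) :
    galAdicCompletionMap (L := E) c hw (algebraMap E (w.1.adicCompletion E) x) = algebraMap E (w.1.adicCompletion E) (c x) := by
  rw [← coe_eq_algebraMap, ← coe_eq_algebraMap]
  exact galAdicCompletionMap_coe_algEquiv (σ := c) (h := hw) (x := x)

/-- in `ℤₘ₀`, `x ^ n = 1` with `n ≠ 0` forces `x = 1`. [folklore] -/
private theorem eq_one_of_pow_eq_one {x : WithZero (Multiplicative ℤ)} {n : ℕ} (hn : n ≠ 0) (h : x ^ n = 1) : x = 1 := by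
  rcases lt_trichotomy x 1 with hx | hx | hx
  · exact absurd h (pow_lt_one₀ zero_le hx hn).ne
  · exact hx
  · exact absurd h (one_lt_pow₀ hx hn).ne'

/-- `δ² ∈ F` for `c δ = -δ` (write `δ² = x + yδ`; applying `c` gives `y = 0`). [folklore] -/
private theorem exists_delta_mul_self_eq_algebraMap {δ : E} (hcδ : c δ = -δ) (hδ : δ ≠ 0) :
    ∃ d : F, δ * δ = algebraMap F E d := by
  obtain ⟨x, y, hxy⟩ := exists_eq_add_mul_of_isQuadraticExtension (F := F) (E := E)
    (not_mem_range_algebraMap_of_apply_eq_neg E c hcδ hδ) (δ * δ)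
  have hc2 : c (δ * δ) = δ * δ := by rw [map_mul, hcδ, neg_mul_neg]
  have hy : algebraMap F E y * δ = 0 := by
    have h1 : c (δ * δ) = algebraMap F E x - algebraMap F E y * δ := by
      rw [hxy, map_add, map_mul, AlgEquiv.commutes, AlgEquiv.commutes, hcδ, mul_neg, sub_eq_add_neg]
    rw [hc2, hxy] at h1
    have h2 : (2 : E) * (algebraMap F E y * δ) = 0 := by linear_combination h1
    exact (mul_eq_zero.1 h2).resolve_left two_ne_zero
  exact ⟨x, by rw [hxy, hy, add_zero]⟩

/-- **units fixed by `σ_w` are norms of units** at an UNRAMIFIED non-split place [Omeara1963, 63:16; Serre1979, Ch. V §2 Cor.]: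
`|u|_w = 1`, `σ_w u = u ⇒ u = t · σ_w t` with `|t|_w = 1` (`u = ι_w p`, `p = x² - d y²` by the tree's «units are local norms»,
`t = ι_w x + ι_w y · δ`). [cite: Omeara1963, §63C Example 63:16] -/
theorem exists_mul_galAdicCompletionMap_eq_of_isUnramifiedIn (hc : c ≠ 1) (hw : c • w.1 = w.1)
    (hv : Algebra.IsUnramifiedIn (𝓞 E) v.asIdeal) (u : w.1.adicCompletion E) (hu1 : Valued.v u = 1)
    (hfix : galAdicCompletionMap (L := E) c hw u = u) :
    ∃ t : w.1.adicCompletion E, Valued.v t = 1 ∧ t * galAdicCompletionMap (L := E) c hw t = u := by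
  -- `u = ι_w p`, `|p|_v = 1`
  obtain ⟨p, hp⟩ := exists_toPlace_eq_of_galAdicCompletionMap_eq c w hc hw u hfix
  haveI := PlacesOver.liesOver w
  have hp1 : Valued.v p = 1 := by
    have h := hu1
    rw [← hp, valued_toPlace] at h
    exact eq_one_of_pow_eq_one (Ideal.IsDedekindDomain.ramificationIdx'_ne_zero_of_liesOver w.1.asIdeal v.ne_bot) h
  -- `E = F(δ)`, `c δ = -δ`, `δ² = d`
  obtain ⟨σ, δ, hσδ, hδ⟩ := exists_algEquiv_apply_eq_neg (F := F) (E := E)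
  have hσ1 : σ ≠ 1 := by
    rintro rfl
    rw [AlgEquiv.one_apply] at hσδ
    have h2 : (2 : E) * δ = 0 := by linear_combination hσδ
    exact hδ ((mul_eq_zero.mp h2).resolve_left two_ne_zero)
  obtain rfl : σ = c := (Literature.NumberTheory.Automorphic.algEquiv_eq_one_or_eq (F := F) hc σ).resolve_left hσ1
  obtain ⟨d, hd⟩ := exists_delta_mul_self_eq_algebraMap σ hσδ hδ
  have hα : δ ^ 2 = algebraMap F E d := by rw [sq, hd]
  have hαK : ∀ r : F, algebraMap F E r ≠ δ := fun r hr =>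
    not_mem_range_algebraMap_of_apply_eq_neg E σ hσδ hδ ⟨r, hr⟩
  -- units are local norms at an unramified place
  obtain ⟨x, y, hxy⟩ := exists_sq_sub_mul_sq_eq_of_valued_eq_one_of_isUnramifiedIn F v hα hαK hv hp1
  set δw : w.1.adicCompletion E := algebraMap E (w.1.adicCompletion E) δ with hδwdef
  set t : w.1.adicCompletion E := toPlace v w x + toPlace v w y * δw with htdef
  have hσt : galAdicCompletionMap (L := E) σ hw t = toPlace v w x - toPlace v w y * δw := by
    rw [htdef, map_add, map_mul, galAdicCompletionMap_toPlace σ w w hw, galAdicCompletionMap_toPlace σ w w hw, hδwdef,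
      galAdicCompletionMap_algebraMap σ w hw, hσδ, map_neg]
    ring
  have hdv : (d : v.adicCompletion F) = algebraMap F (v.adicCompletion F) d := by
    rw [IsDedekindDomain.HeightOneSpectrum.algebraMap_adicCompletion]
    rfl
  have hδK : δw * δw = toPlace v w (algebraMap F (v.adicCompletion F) d) := by
    rw [← hdv, toPlace_coe v w d, coe_eq_algebraMap, hδwdef, ← map_mul, hd]
  have htt : t * galAdicCompletionMap (L := E) σ hw t = u := by
    rw [hσt, htdef, ← hp, ← hxy, map_sub, map_mul, map_pow, map_pow]
    have : (toPlace v w x + toPlace v w y * δw) * (toPlace v w x - toPlace v w y * δw) =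
        toPlace v w x ^ 2 - toPlace v w y ^ 2 * (δw * δw) := by
      ring
    rw [this, hδK]
    ring
  have ht1 : Valued.v t = 1 := by
    have h := congrArg Valued.v htt
    rw [map_mul, valued_galAdicCompletionMap, hu1, ← sq] at h
    exact eq_one_of_pow_eq_one two_ne_zero h
  exact ⟨t, ht1, htt⟩

/-! ## §4 Piece (2a): a `σ_w`-HYPERBOLIC integral basis for `J_w` -/

/-- **Piece (2a) `HyperbolicBasis` of the line `b4-hyperspecial-gelfand-pair` (sub-stub `stub_hyperbolicBasis`, skeleton v3
sha16 9a4ac4416ebf167b, binders verbatim)** — [Jacobowitz1962, §7 Thm. 7.1]: at a place `v` of `F` that is UNRAMIFIED and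
NON-SPLIT in the quadratic extension `E` (`c • w = w`) and NON-DYADIC, a `c`-hermitian `J ∈ M_N(E)` that is `w`-unimodular
(`placeForm J w ∈ GL_N(𝒪_w)`) admits `T ∈ GL_N(𝒪_w)` with `placeForm J w = (σ_w T)ᵀ · antidiag(1, …, 1) · T`: the unimodular
hermitian lattice `(𝒪_wᴺ, J_w)` has a hyperbolic basis.  Proof: `HermitianUnimodular.exists_formCongr_eq` over the discrete
valuation ring `𝒪[E_w]` with the involution `σ_w|` (trace: `½`; norm: `exists_mul_galAdicCompletionMap_eq_of_isUnramifiedIn`),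
transported along `𝒪[E_w] ↪ E_w`. [cite: Jacobowitz1962, §7 Thm. 7.1] -/
theorem exists_glInt_placeForm_eq_formCongr_antidiagonal (F E : Type) [Field F] [NumberField F] [Field E] [NumberField E]
    [Algebra F E] [Algebra.IsQuadraticExtension F E] (c : E ≃ₐ[F] E) (hc1 : c ≠ 1) (N : ℕ)
    (J : Matrix (Fin N) (Fin N) E) (hJh : (J.map c)ᵀ = J) (_hJ : IsUnit J.det)
    (v : HeightOneSpectrum (𝓞 F)) (w : PlacesOver E v) (hw : c • w.1 = w.1)
    (hv : Algebra.IsUnramifiedIn (𝓞 E) v.asIdeal) (h2 : (2 : 𝓞 F) ∉ v.asIdeal)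
    (hJw : IsUnit (placeForm J w.1)) (hJi : hJw.unit ∈ glInt N (w.1.adicCompletion E)) :
    ∃ T : GL (Fin N) (w.1.adicCompletion E), T ∈ glInt N (w.1.adicCompletion E) ∧
      placeForm J w.1 =
        formCongr (galAdicCompletionMap (L := E) c hw) T ((StdForm.antidiagonal N).over (w.1.adicCompletion E)) := by
  haveI : CharZero (w.1.adicCompletion E) := charZero_of_injective_algebraMap (algebraMap E _).injective
  -- the involution `σ_w` restricted to the valuation ring `𝒪 = 𝒪[E_w]`
  have hmem : ∀ x ∈ 𝒪[w.1.adicCompletion E], galAdicCompletionMap (L := E) c hw x ∈ 𝒪[w.1.adicCompletion E] :=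
    fun x hx => galAdicCompletionMap_mem_integer c w hw hx
  let σO : 𝒪[w.1.adicCompletion E] →+* 𝒪[w.1.adicCompletion E] :=
    (galAdicCompletionMap (L := E) c hw).restrict 𝒪[w.1.adicCompletion E] 𝒪[w.1.adicCompletion E] hmem
  have hσO : ∀ x : 𝒪[w.1.adicCompletion E], ((σO x : 𝒪[w.1.adicCompletion E]) : w.1.adicCompletion E) =
      galAdicCompletionMap (L := E) c hw x := fun _ => rfl
  have hσσ : ∀ x, σO (σO x) = x := fun x =>
    Subtype.ext (galAdicCompletionMap_galAdicCompletionMap_of_smul_eq c w hc1 hw x)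
  -- (trace): `b = ½ ∈ 𝒪` at a non-dyadic place
  have hv2 : Valued.v (2 : w.1.adicCompletion E) = 1 := valued_two_eq_one w h2
  have h2mem : (2 : w.1.adicCompletion E)⁻¹ ∈ 𝒪[w.1.adicCompletion E] := by
    rw [mem_integer_iff_mem_adicCompletionIntegers, HeightOneSpectrum.mem_adicCompletionIntegers, map_inv₀, hv2, inv_one]
  have htr : ∃ b : 𝒪[w.1.adicCompletion E], b + σO b = 1 := by
    refine ⟨⟨(2 : w.1.adicCompletion E)⁻¹, h2mem⟩, Subtype.ext ?_⟩
    change (2 : w.1.adicCompletion E)⁻¹ + galAdicCompletionMap (L := E) c hw (2 : w.1.adicCompletion E)⁻¹ = 1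
    rw [map_inv₀, map_ofNat, ← two_mul, mul_inv_cancel₀ two_ne_zero]
  -- (norm): `σ_w`-fixed units of `𝒪` are norms `t σ_w(t)`
  have hnorm : ∀ u : 𝒪[w.1.adicCompletion E], IsUnit u → σO u = u → ∃ t : 𝒪[w.1.adicCompletion E], t * σO t = u := by
    intro u hu hσu
    have hu1 : Valued.v (u : w.1.adicCompletion E) = 1 := by
      rw [← (ValuativeRel.isEquiv (ValuativeRel.valuation (w.1.adicCompletion E))
        (Valued.v : Valuation (w.1.adicCompletion E) _)).eq_one_iff_eq_one]
      exact Valuation.Integers.one_of_isUnit (Valuation.integer.integers _) hu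
    have hfix : galAdicCompletionMap (L := E) c hw u = u := by rw [← hσO, hσu]
    obtain ⟨t, ht1, htt⟩ := exists_mul_galAdicCompletionMap_eq_of_isUnramifiedIn c w hc1 hw hv u hu1 hfix
    have htmem : t ∈ 𝒪[w.1.adicCompletion E] := by
      rw [mem_integer_iff_mem_adicCompletionIntegers, HeightOneSpectrum.mem_adicCompletionIntegers, ht1]
    exact ⟨⟨t, htmem⟩, Subtype.ext htt⟩
  -- pull the two forms back to `GL_N(𝒪)`
  obtain ⟨H₀, hH₀⟩ := hJi
  have hH₀val : (H₀ : Matrix (Fin N) (Fin N) 𝒪[w.1.adicCompletion E]).map (𝒪[w.1.adicCompletion E]).subtype = placeForm J w.1 := by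
    have h := congrArg (fun g : GL (Fin N) (w.1.adicCompletion E) => (g : Matrix (Fin N) (Fin N) (w.1.adicCompletion E))) hH₀
    rw [IsUnit.unit_spec] at h
    exact h
  have hinj : Function.Injective fun M : Matrix (Fin N) (Fin N) 𝒪[w.1.adicCompletion E] =>
      M.map (𝒪[w.1.adicCompletion E]).subtype := Matrix.map_injective Subtype.val_injective
  have hcomm : (⇑(𝒪[w.1.adicCompletion E]).subtype ∘ ⇑σO) = ⇑(galAdicCompletionMap (L := E) c hw) ∘ ⇑(𝒪[w.1.adicCompletion E]).subtype :=
    funext fun x => hσO x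
  have hH₀h : ((H₀ : Matrix (Fin N) (Fin N) 𝒪[w.1.adicCompletion E]).map σO)ᵀ = H₀ := by
    apply hinj
    change (((Units.val H₀).map σO)ᵀ).map _ = (Units.val H₀).map _
    rw [Matrix.transpose_map, Matrix.map_map, hcomm, ← Matrix.map_map, hH₀val]
    exact placeForm_hermitian_of_smul_eq c w J hJh hw
  have hH₀det : IsUnit (Units.val H₀).det := by
    rw [← Matrix.isUnit_iff_isUnit_det]
    exact Units.isUnit H₀
  have hJ₀h : (((StdForm.antidiagonal N).over 𝒪[w.1.adicCompletion E]).map σO)ᵀ = (StdForm.antidiagonal N).over 𝒪[w.1.adicCompletion E] := by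
    rw [StdForm.over_map, StdForm.transpose_over]
  have hJ₀det : IsUnit ((StdForm.antidiagonal N).over 𝒪[w.1.adicCompletion E]).det :=
    (Matrix.isUnit_iff_isUnit_det _).1 (StdForm.isUnit_over _ _)
  -- Jacobowitz over the local ring `𝒪`
  obtain ⟨T₀, hT₀⟩ := HermitianUnimodular.exists_formCongr_eq σO hσσ htr hnorm
    (H₀ : Matrix (Fin N) (Fin N) 𝒪[w.1.adicCompletion E]) ((StdForm.antidiagonal N).over 𝒪[w.1.adicCompletion E])
    hH₀h hH₀det hJ₀h hJ₀det
  refine ⟨Matrix.GeneralLinearGroup.map (𝒪[w.1.adicCompletion E]).subtype T₀, ⟨T₀, rfl⟩, ?_⟩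
  -- push the congruence forward along `𝒪 ↪ E_w`
  have h := congrArg (fun M : Matrix (Fin N) (Fin N) 𝒪[w.1.adicCompletion E] => M.map (𝒪[w.1.adicCompletion E]).subtype) hT₀
  simp only [formCongr, Matrix.map_mul, Matrix.transpose_map, Matrix.map_map, hcomm, StdForm.over_map, hH₀val] at h
  rw [← h]
  rfl

end Literature.NumberTheory.Automorphic.UnitaryGroup

end
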